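import Mathlib
import Literature.Computability.AlgebraicComplexity.ChartUSP
import Literature.Computability.AlgebraicComplexity.SimultaneousDoubleProduct

/-! Toy check of the cross-class claim of `stub_rowsOfCornerFree` (line clustered-charts, crux stmt-10647):
a 2-pair SDPP family in ℤ/13 with DISJOINT difference sets (two classes of size 1), and the 8 rows of width 3
`row u c = (g_c(u), role c)` for all class words g ∈ (Fin 2)³.  Claim: local chart-USP. -/

open Literature.Computability.AlgebraicComplexity Finset
open scoped Pointwise

namespace ToyCheck

def A : Fin 2 → Finset (ZMod 13) := ![{0, 4}, {10, 12}]
def B : Fin 2 → Finset (ZMod 13) := ![{5, 7}, {8, 12}]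

def chartA (x : Fin 2 × Fin 3) : Finset (ZMod 13) := (![A x.1, {0}, B x.1] : Fin 3 → Finset (ZMod 13)) x.2
def chartB (x : Fin 2 × Fin 3) : Finset (ZMod 13) := (![B x.1, A x.1, {0}] : Fin 3 → Finset (ZMod 13)) x.2
def chartC (x : Fin 2 × Fin 3) : Finset (ZMod 13) := (![{0}, B x.1, A x.1] : Fin 3 → Finset (ZMod 13)) x.2

/-- rows: u : Fin 8 read as three bits (g₀,g₁,g₂); coordinate c has role c and symbol value g_c. -/
def row (u : Fin 8) (c : Fin 3) : Fin 2 × Fin 3 :=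
  (⟨(u.val / 2 ^ c.val) % 2, Nat.mod_lt _ (by norm_num)⟩, c)

set_option maxHeartbeats 4000000 in
theorem sdpp : IsSDPP A B := by
  refine ⟨?_, ?_⟩
  · unfold A B; decide
  · unfold A B; decide

set_option maxHeartbeats 4000000 in
theorem rows_usp : IsLocalChartUSP chartA chartB chartC row := by
  simp only [IsLocalChartUSP, mem_chartHypergraph_iff]
  native_decide

end ToyCheck

/-! Negative control: a 2-pair SDPP family in ℤ/13 whose difference sets INTERSECT (one class).  The same 8
rows must now FAIL to be a local chart-USP (rows differing on one role block only violate). -/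
namespace ToyControl

open Literature.Computability.AlgebraicComplexity Finset

def A : Fin 2 → Finset (ZMod 13) := ![{0, 9}, {10, 12}]
def B : Fin 2 → Finset (ZMod 13) := ![{1, 9}, {2, 6}]

def chartA (x : Fin 2 × Fin 3) : Finset (ZMod 13) := (![A x.1, {0}, B x.1] : Fin 3 → Finset (ZMod 13)) x.2
def chartB (x : Fin 2 × Fin 3) : Finset (ZMod 13) := (![B x.1, A x.1, {0}] : Fin 3 → Finset (ZMod 13)) x.2
def chartC (x : Fin 2 × Fin 3) : Finset (ZMod 13) := (![{0}, B x.1, A x.1] : Fin 3 → Finset (ZMod 13)) x.2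

def row (u : Fin 8) (c : Fin 3) : Fin 2 × Fin 3 :=
  (⟨(u.val / 2 ^ c.val) % 2, Nat.mod_lt _ (by norm_num)⟩, c)

set_option maxHeartbeats 4000000 in
theorem sdpp : IsSDPP A B := by
  refine ⟨?_, ?_⟩
  · unfold A B; decide
  · unfold A B; decide

set_option maxHeartbeats 4000000 in
theorem rows_not_usp : ¬ IsLocalChartUSP chartA chartB chartC row := by
  simp only [IsLocalChartUSP, mem_chartHypergraph_iff]
  native_decide

end ToyControl
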